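import Mathlib
import Summits.Ventures.PercRepro.TriangleCapBroom

/-!
# PercRepro — THE ORDERED ADJACENT PAIRS INSIDE A SET ARE TWICE THE EDGES INSIDE IT, AND `K₄⁻`-FREENESS FROM
THE COMMON NEIGHBOURS (p3, gen 43; part 187)

Two small tools for the second-order stability of the row `a = 3` (§10bu): `restrict D S` = the edges of `D`
inside `S` as a graph on `V`, whose edge count `M` satisfies `adjPairs D S = 2 M` (`adjPairs_eq_two_mul`);
and the converse of `card_inter_le_one_of_adj`: a graph in which every edge has at most one common neighbour
is `K₄⁻`-free (`k4mFree_of_common_le_one`) — a `4`-set with `9` ordered adjacent pairs has a vertex `u`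
adjacent to the other three, and two of those three are adjacent, so the edge from `u` to the middle one has
two common neighbours. Axioms: standard.
-/

namespace PercRepro

namespace TriangleCap

namespace C047

open Finset

variable {V : Type*} [Fintype V] [DecidableEq V]

/-- The edges of `D` inside `S`, as a graph on `V`. -/
def restrict (D : SimpleGraph V) (S : Finset V) : SimpleGraph V where
  Adj a b := D.Adj a b ∧ a ∈ S ∧ b ∈ S
  symm := ⟨fun _ _ h => ⟨D.adj_symm h.1, h.2.2, h.2.1⟩⟩
  loopless := ⟨fun _ h => D.irrefl h.1⟩

/-- Adjacency in the restriction is decidable. -/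
instance decidableRelRestrict (D : SimpleGraph V) [DecidableRel D.Adj] (S : Finset V) :
    DecidableRel (restrict D S).Adj :=
  fun a b => inferInstanceAs (Decidable (D.Adj a b ∧ a ∈ S ∧ b ∈ S))

omit [Fintype V] [DecidableEq V] in
/-- Adjacency in the restriction. -/
theorem restrict_adj (D : SimpleGraph V) (S : Finset V) (a b : V) :
    (restrict D S).Adj a b ↔ D.Adj a b ∧ a ∈ S ∧ b ∈ S := Iff.rfl

/-- The ordered adjacent pairs of the restriction over everything are the ordered adjacent pairs of `D` in `S`. -/
theorem adjPairs_restrict_univ (D : SimpleGraph V) [DecidableRel D.Adj] (S : Finset V) :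
    adjPairs (restrict D S) univ = adjPairs D S := by
  unfold adjPairs
  congr 1
  ext p
  simp only [mem_filter, mem_product, mem_univ, true_and, restrict_adj]
  tauto

/-- **THE ORDERED ADJACENT PAIRS INSIDE `S` ARE TWICE THE EDGES INSIDE `S`.** -/
theorem adjPairs_eq_two_mul (D : SimpleGraph V) [DecidableRel D.Adj] (S : Finset V) :
    adjPairs D S = 2 * (restrict D S).edgeFinset.card := by
  have h := two_mul_card_edges_eq_adjPairs_add (restrict D S) univ
  rw [adjPairs_restrict_univ] at h
  simp only [compl_univ, sum_empty, mul_zero, add_zero] at h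
  omega

/-- **`K₄⁻`-FREENESS FROM THE COMMON NEIGHBOURS:** if every edge `u v` has at most one common neighbour, `D` is
`K₄⁻`-free. -/
theorem k4mFree_of_common_le_one (D : SimpleGraph V) [DecidableRel D.Adj]
    (h : ∀ u v, D.Adj u v → ((univ.filter (fun w => D.Adj u w)) ∩ (univ.filter (fun w => D.Adj v w))).card ≤ 1) :
    K4mFree D := by
  intro S hS
  by_contra hcon
  push Not at hcon
  rw [adjPairs_eq_sum_degIn] at hcon
  -- a vertex `u ∈ S` adjacent to the other three
  have hu : ∃ u ∈ S, degIn D S u = 3 := by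
    by_contra hall
    push Not at hall
    have hle : ∑ u ∈ S, degIn D S u ≤ ∑ _u ∈ S, 2 := by
      apply sum_le_sum
      intro u hu
      have h1 := degIn_le_card_sub_one D hu
      have h2 := hall u hu
      omega
    rw [sum_const, hS, smul_eq_mul] at hle
    omega
  obtain ⟨u, huS, hu3⟩ := hu
  have hfilt : S.filter (fun w => D.Adj u w) = S.erase u := by
    apply eq_of_subset_of_card_le
    · intro w hw
      rw [mem_filter] at hw
      rw [mem_erase]
      exact ⟨(D.ne_of_adj hw.2).symm, hw.1⟩
    · rw [card_erase_of_mem huS, hS]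
      unfold degIn at hu3
      omega
  have hadj : ∀ w ∈ S, w ≠ u → D.Adj u w := by
    intro w hw hne
    have : w ∈ S.filter (fun w => D.Adj u w) := by
      rw [hfilt, mem_erase]
      exact ⟨hne, hw⟩
    exact (mem_filter.mp this).2
  -- the other three carry `≥ 6` ordered pairs into `S`, i.e. `≥ 3` among themselves
  have hsplit : ∑ w ∈ S, degIn D S w = degIn D S u + ∑ w ∈ S.erase u, degIn D S w := by
    rw [← add_sum_erase S _ huS]
  have hinner : ∀ w ∈ S.erase u, degIn D S w = degIn D (S.erase u) w + 1 := by
    intro w hw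
    rw [mem_erase] at hw
    unfold degIn
    rw [filter_erase, card_erase_of_mem]
    · have : 1 ≤ (S.filter (fun y => D.Adj w y)).card :=
        card_pos.mpr ⟨u, mem_filter.mpr ⟨huS, D.adj_symm (hadj w hw.2 hw.1)⟩⟩
      omega
    · exact mem_filter.mpr ⟨huS, D.adj_symm (hadj w hw.2 hw.1)⟩
  have hsum3 : 3 ≤ ∑ w ∈ S.erase u, degIn D (S.erase u) w := by
    have this : ∑ w ∈ S.erase u, degIn D S w = ∑ w ∈ S.erase u, (degIn D (S.erase u) w + 1) :=
      sum_congr rfl hinner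
    rw [sum_add_distrib, sum_const, card_erase_of_mem huS, hS, smul_eq_mul] at this
    omega
  -- the pairs inside `S.erase u` are even, hence `≥ 4`, hence some vertex has two neighbours there
  have heven := adjPairs_eq_two_mul D (S.erase u)
  rw [adjPairs_eq_sum_degIn] at heven
  have hw2 : ∃ w ∈ S.erase u, 2 ≤ degIn D (S.erase u) w := by
    by_contra hall
    push Not at hall
    have hle : ∑ w ∈ S.erase u, degIn D (S.erase u) w ≤ ∑ _w ∈ S.erase u, 1 := by
      apply sum_le_sum
      intro w hw
      have := hall w hw
      omega
    rw [sum_const, card_erase_of_mem huS, hS, smul_eq_mul] at hle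
    omega
  obtain ⟨w, hwS, hw2⟩ := hw2
  rw [mem_erase] at hwS
  -- the two neighbours of `w` inside `S.erase u` are common neighbours of `u` and `w`
  have hsub : (S.erase u).filter (fun y => D.Adj w y) ⊆
      (univ.filter (fun y => D.Adj u y)) ∩ (univ.filter (fun y => D.Adj w y)) := by
    intro y hy
    rw [mem_filter, mem_erase] at hy
    rw [mem_inter, mem_filter, mem_filter]
    exact ⟨⟨mem_univ y, hadj y hy.1.2 hy.1.1⟩, ⟨mem_univ y, hy.2⟩⟩
  have h1 := card_le_card hsub
  have h2 := h u w (hadj w hwS.2 hwS.1)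
  unfold degIn at hw2
  omega

end C047

end TriangleCap

end PercRepro
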